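import Literature.Computability.Complexity.OracleClosure
import Literature.Computability.Complexity.OracleProofs
import Literature.Computability.Complexity.IterateFP
import HarnessLib

/-!
# `P^∅ = P` (discharge of `PRel_empty`): simulating an oracle algorithm by clocked iteration

Trunk `CplxCore`, sibling proof file of `Oracle.lean` (D-0014). It discharges

* `Literature.CplxCore.PRel_empty_holds : PRel_empty` — `PRel Oracle.empty = P`
  (Baker–Gill–Solovay 1975, §1: the empty oracle gives no power).

`P ⊆ P^∅` is the query-free embedding `P_subset_PRel_holds` (`OracleProofs.lean`). For
`P^∅ ⊆ P`, let `L ∈ P^∅` be decided by the oracle algorithm `M` (transcript model of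
`Oracle.lean`: a polynomial-time step function `(x, answers so far) ↦ query | output`) within
`q(|x|)` rounds. Against the empty oracle every answer is the constant `encodeBool false = [0]`,
so the whole interaction is the `q(|x|)`-fold iteration of the *closed* one-round map

  `simStep M (x, answers) = (x, answers ++ [[0]])` if `M.step x answers` is a query, and
  `= (x, answers)` if it is an output,

followed by reading off the output (`simOut`); `simOut M ((simStep M)^[k] (x, as)) = b` whenever
`M.runAux ∅ x k as = some b` (`simOut_iterate`). The decider is assembled — no Turing machine is
programmed — from the tree's `FinTM2` toolkit by composition (`PolyTimeComputable.comp_holds`):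

1. input preparation `x ↦ none^{q(|x|)} ++ ⟨x, ⟨1⁰, []⟩⟩.map some` (the iteration count in
   unary: `evalHdrFn q` of `UnaryArithMachines.lean`, recoded by the transducer `itInit` of
   `IterateFP.lean`);
2. the clocked-iteration combinator `PolyTimeComputable.iterate_of_le_add` (`TM2Iterate.lean`)
   applied to `simStep M`, whose string form on `encIn (x, answers)` (the step-function input
   format `⟨x, listBool answers⟩`) is: duplicate (`copyFn`, `PrePost.toField`), run the step
   machine of `M` on the first copy keeping the second as context
   (`PolyTimeComputable.firstField`, `TM2Context.lean`), return to pairs (`PrePost.fromField`),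
   keep the tag bit (`headT`), and let the transducer `updT` either copy the state (tag `inr`) or
   insert the unary increment `11` of the answer count and announce the new answer
   `⟨[0], []⟩ = 0001` in a prefix field which `swapFn` and the flattening transducer `concatT`
   move to the end; each round adds at most `6` symbols;
3. one more run of the step machine and the output transducer `outT` (`1b… ↦ b`, `0… ↦ 0`).

## References

* T. Baker, J. Gill, R. Solovay, *Relativizations of the P =? NP question*, SIAM J. Comput. 4
  (1975) 431–442, §1 (relativised classes; `P^∅ = P`).
* S. Arora, B. Barak, *Computational Complexity: A Modern Approach*, CUP 2009, §3.4 (oracle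
  machines), Example 3.6 (2) ("if `O ∈ P` then `P^O = P`"), §1.3–1.4 (machine constructions,
  clocked simulation).
-/

namespace Literature.Computability.Complexity

open _root_.Computability

namespace EmptySim

/-! ### The one-round map and its correctness -/

/-- States of the simulation: (input, answers received so far). [Arora–Barak 2009, §3.4] [cite: AroraBarak2009, §3.4] -/
abbrev St : Type := List Bool × List (List Bool)

/-- **One round against the empty oracle**: a query is answered by the constant `[0]`
(`Oracle.empty_apply`), an output freezes the state. [Baker–Gill–Solovay 1975, §1] [cite: BakerGillSolovay1975, §1] -/
def simStep (M : OracleAlg Bool) (p : St) : St :=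
  match M.step p.1 p.2 with
  | Sum.inl _ => (p.1, p.2 ++ [[false]])
  | Sum.inr _ => p

/-- The output read off a state: the output of `M` if its step is an output, junk `0` otherwise. [folklore] -/
def simOut (M : OracleAlg Bool) (p : St) : Bool :=
  match M.step p.1 p.2 with
  | Sum.inl _ => false
  | Sum.inr b => b

/-- **Correctness of the simulation**: if the run of `M` against `∅` from the transcript `as`
outputs `b` within `k` rounds, then `k` rounds of `simStep` from `(x, as)` reach a state whose
output is `b`. [Baker–Gill–Solovay 1975, §1] [cite: BakerGillSolovay1975, §1] -/
theorem simOut_iterate (M : OracleAlg Bool) (x : List Bool) {k : ℕ} {as : List (List Bool)}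
    {b : Bool} (h : M.runAux Oracle.empty x k as = some b) :
    simOut M ((simStep M)^[k] (x, as)) = b := by
  induction k generalizing as with
  | zero => simp at h
  | succ k ih =>
    rw [OracleAlg.runAux_succ] at h
    cases hs : M.step x as with
    | inl q =>
      rw [hs] at h
      dsimp only at h
      have hF : simStep M (x, as) = (x, as ++ [[false]]) := by
        simp only [simStep, hs]
      rw [Function.iterate_succ_apply, hF]
      apply ih
      have he : Oracle.empty q = [false] := by rw [Oracle.empty_apply]; rfl
      rwa [he] at h
    | inr b' =>
      rw [hs] at h
      dsimp only at h
      simp only [Option.some.injEq] at h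
      subst h
      have hF : simStep M (x, as) = (x, as) := by simp only [simStep, hs]
      rw [Function.iterate_fixed hF]
      simp only [simOut, hs]

/-- Each round adds one constant answer: the encoded state grows by at most `6` symbols
(`|⟨x, listBool (as ++ [[0]])⟩| = |⟨x, listBool as⟩| + 6`). [folklore] -/
theorem length_encIn_simStep_le (M : OracleAlg Bool) (p : St) :
    (OracleAlg.encIn (simStep M p)).length ≤ (OracleAlg.encIn p).length + 6 := by
  obtain ⟨x, as⟩ := p
  have hfold : ∀ (l : List (List Bool)) (init : List Bool),
      l.foldr (fun a acc => boolPair ((encodingList Bool).encode a) acc) init =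
        l.foldr (fun a acc => boolPair ((encodingList Bool).encode a) acc) [] ++ init := by
    intro l init
    induction l with
    | nil => rfl
    | cons a l ih => rw [List.foldr_cons, List.foldr_cons, ih]; simp [boolPair, List.append_assoc]
  unfold simStep
  cases M.step x as with
  | inr _ => simp
  | inl _ =>
    simp only [OracleAlg.encIn, Encoding.listBool, length_boolPair, List.length_append,
      List.length_cons, List.length_nil, List.foldr_append, List.foldr_cons, List.foldr_nil]
    rw [hfold as (boolPair _ [])]
    simp only [List.length_append, length_boolPair, List.length_nil, unaryEncodeNat,
      List.length_cons]
    have : ((encodingList Bool).encode [false]).length = 1 := rfl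
    omega

/-! ### The transducers -/

/-- States of the head transducer: before / after the first symbol. [folklore] -/
inductive HS
  | start
  | dead
  deriving DecidableEq, Fintype

/-- Transition of `headT`: keep the first symbol, drop the rest. [folklore] -/
def headStep : HS → Bool → HS × List Bool
  | .start, b => (.dead, [b])
  | .dead, _ => (.dead, [])

/-- **The first symbol of a string** as a transduction (`headT_eval_cons`). [folklore] -/
def headT : FST HS Bool Bool where
  init := .start
  step := headStep
  front := fun _ => []
  keep := fun _ => true

/-- The transition of `headT` (definitional). [folklore] -/
@[simp] theorem headT_step (s : HS) (b : Bool) : headT.step s b = headStep s b := rfl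

/-- The absorbing state of `headT` emits nothing. [folklore] -/
theorem headT_run_dead (l : List Bool) : (headT.run .dead l).2 = [] := by
  induction l with
  | nil => rfl
  | cons b l ih => simp [FST.run_cons, headStep, ih]

/-- **`headT (a :: l) = [a]`.** [folklore] -/
theorem headT_eval_cons (a : Bool) (l : List Bool) : headT.eval (a :: l) = [a] := by
  have he : headT.eval (a :: l) = (headT.run .start (a :: l)).2 := by simp [FST.eval, headT]
  rw [he]
  simp [FST.run_cons, headStep, headT_run_dead]

/-- States of the update transducer `updT`: reading the tag field `tt01` (`u0`, `u1 t`, `u2 t`,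
`u3 t`), then copying (`copyT`, tag `1`) or inserting after the first separator (`insEv`,
`insOd b`, then `copyF`; tag `0`). [folklore] -/
inductive US
  | u0
  | u1 (t : Bool)
  | u2 (t : Bool)
  | u3 (t : Bool)
  | copyT
  | insEv
  | insOd (b : Bool)
  | copyF
  deriving DecidableEq, Fintype

/-- Transition of `updT` (see `US`): in insert mode the first unequal pair `bb'` (the separator
`01` of `⟨x, ·⟩`) is followed by the unary increment `11`. [folklore] -/
def updStep : US → Bool → US × List Bool
  | .u0, t => (.u1 t, [])
  | .u1 t, _ => (.u2 t, [])
  | .u2 t, _ => (.u3 t, [])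
  | .u3 t, _ => (if t then .copyT else .insEv, [])
  | .copyT, c => (.copyT, [c])
  | .insEv, b => (.insOd b, [])
  | .insOd b, b' => if b = b' then (.insEv, [b, b']) else (.copyF, [b, b', true, true])
  | .copyF, c => (.copyF, [c])

/-- The prefix field announced by `updT`: in insert mode (final state `copyF`) the code
`⟨0001, ·⟩ = ⟨⟨[0], []⟩, ·⟩` of the new constant answer, otherwise the empty field `⟨[], ·⟩`. [folklore] -/
def updFront : US → List Bool
  | .copyF => boolPair [false, false, false, true] []
  | _ => boolPair [] []

/-- **The update transducer**: `⟨[1], z⟩ ↦ ⟨[], z⟩` and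
`⟨[0], ⟨x, rest⟩⟩ ↦ ⟨0001, ⟨x, 11 rest⟩⟩` (`updT_eval_true`, `updT_eval_false`). [Arora–Barak 2009, §1.3 (finite control)] [cite: AroraBarak2009, §1.3] -/
def updT : FST US Bool Bool where
  init := .u0
  step := updStep
  front := updFront
  keep := fun _ => true

/-- The transition of `updT` (definitional). [folklore] -/
@[simp] theorem updT_step (s : US) (b : Bool) : updT.step s b = updStep s b := rfl

/-- The plain copier of `updT`. [folklore] -/
theorem updT_run_copyT (l : List Bool) : updT.run .copyT l = (.copyT, l) := by
  induction l with
  | nil => rfl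
  | cons b l ih => simp [FST.run_cons, updStep, ih]

/-- The final copier of `updT`. [folklore] -/
theorem updT_run_copyF (l : List Bool) : updT.run .copyF l = (.copyF, l) := by
  induction l with
  | nil => rfl
  | cons b l ih => simp [FST.run_cons, updStep, ih]

/-- Insert mode of `updT` on `⟨x, rest⟩`: the doubled `x` is copied, the separator is followed
by `11`, the rest is copied. [folklore] -/
theorem updT_run_insEv (x rest : List Bool) :
    updT.run .insEv (boolPair x rest) = (.copyF, boolPair x (true :: true :: rest)) := by
  induction x with
  | nil => simp [boolPair, FST.run_cons, updStep, updT_run_copyF]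
  | cons b x ih =>
    have hc : ∀ r : List Bool, boolPair (b :: x) r = b :: b :: boolPair x r := fun r => by
      simp [boolPair]
    rw [hc, hc]
    simp [FST.run_cons, updStep, ih]

/-- **Update, tag `1` (output produced)**: the state is copied into the second field, the prefix
field is empty. [Arora–Barak 2009, §1.3] [cite: AroraBarak2009, §1.3] -/
theorem updT_eval_true (z : List Bool) : updT.eval (boolPair [true] z) = boolPair [] z := by
  have he : ∀ w, updT.eval w = updFront (updT.run .u0 w).1 ++ (updT.run .u0 w).2 := fun w => by
    simp [FST.eval, updT]
  have hc : boolPair [true] z = true :: true :: false :: true :: z := by simp [boolPair]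
  rw [he, hc]
  simp [FST.run_cons, updStep, updT_run_copyT, updFront, boolPair]

/-- **Update, tag `0` (query asked)**: `⟨[0], ⟨x, rest⟩⟩ ↦ ⟨0001, ⟨x, 11 rest⟩⟩`. [Arora–Barak 2009, §1.3] [cite: AroraBarak2009, §1.3] -/
theorem updT_eval_false (x rest : List Bool) :
    updT.eval (boolPair [false] (boolPair x rest)) =
      boolPair [false, false, false, true] (boolPair x (true :: true :: rest)) := by
  have he : ∀ w, updT.eval w = updFront (updT.run .u0 w).1 ++ (updT.run .u0 w).2 := fun w => by
    simp [FST.eval, updT]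
  have hc : boolPair [false] (boolPair x rest) = false :: false :: false :: true :: boolPair x rest := by
    simp [boolPair]
  rw [he, hc]
  simp only [FST.run_cons, updT_step, updStep, Bool.false_eq_true, if_false, List.nil_append]
  rw [updT_run_insEv]
  simp [updFront, boolPair]

/-- States of the flattening transducer `concatT`: pair reader, then copier. [folklore] -/
inductive CS
  | ev
  | od (b : Bool)
  | copy
  deriving DecidableEq, Fintype

/-- Transition of `concatT`: undouble up to the separator, then copy. [folklore] -/
def concatStep : CS → Bool → CS × List Bool
  | .ev, b => (.od b, [])
  | .od b, b' => if b = b' then (.ev, [b]) else (.copy, [])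
  | .copy, c => (.copy, [c])

/-- **Flattening a pair**: `⟨a, b⟩ ↦ a ++ b` (`concatT_eval`). [Arora–Barak 2009, §0.1] [cite: AroraBarak2009, §0.1] -/
def concatT : FST CS Bool Bool where
  init := .ev
  step := concatStep
  front := fun _ => []
  keep := fun _ => true

/-- The transition of `concatT` (definitional). [folklore] -/
@[simp] theorem concatT_step (s : CS) (b : Bool) : concatT.step s b = concatStep s b := rfl

/-- The copier of `concatT`. [folklore] -/
theorem concatT_run_copy (l : List Bool) : (concatT.run .copy l).2 = l := by
  induction l with
  | nil => rfl
  | cons b l ih => simp [FST.run_cons, concatStep, ih]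

/-- The pair reader of `concatT`. [folklore] -/
theorem concatT_run_ev (a b : List Bool) : (concatT.run .ev (boolPair a b)).2 = a ++ b := by
  induction a with
  | nil => simp [boolPair, FST.run_cons, concatStep, concatT_run_copy]
  | cons c a ih =>
    have hc : boolPair (c :: a) b = c :: c :: boolPair a b := by simp [boolPair]
    rw [hc]
    simp [FST.run_cons, concatStep, ih]

/-- **`concatT ⟨a, b⟩ = a ++ b`.** [Arora–Barak 2009, §0.1] [cite: AroraBarak2009, §0.1] -/
theorem concatT_eval (a b : List Bool) : concatT.eval (boolPair a b) = a ++ b := by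
  have he : concatT.eval (boolPair a b) = (concatT.run .ev (boolPair a b)).2 := by
    simp [FST.eval, concatT]
  rw [he, concatT_run_ev]

/-- **The constant transduction** `z ↦ 01` (the code `⟨1⁰, []⟩ = listBool []` of the empty
transcript). [folklore] -/
def const01T : FST Unit Bool Bool where
  init := ()
  step := fun _ _ => ((), [])
  front := fun _ => [false, true]
  keep := fun _ => false

/-- `const01T z = 01`. [folklore] -/
@[simp] theorem const01T_eval (z : List Bool) : const01T.eval z = [false, true] := by
  simp [FST.eval, const01T]

/-- States of the output transducer `outT`. [folklore] -/
inductive OS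
  | o0
  | o1
  | dead
  deriving DecidableEq, Fintype

/-- Transition of `outT`: `1b… ↦ b`, `0… ↦ 0`. [folklore] -/
def outStep : OS → Bool → OS × List Bool
  | .o0, true => (.o1, [])
  | .o0, false => (.dead, [false])
  | .o1, b => (.dead, [b])
  | .dead, _ => (.dead, [])

/-- **Reading off the answer** from an encoded step result: `encode (inr b) = 1b ↦ b`,
`encode (inl q) = 0q ↦ 0` (`outT_eval_true_cons`, `outT_eval_false_cons`). [folklore] -/
def outT : FST OS Bool Bool where
  init := .o0
  step := outStep
  front := fun _ => []
  keep := fun _ => true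

/-- The transition of `outT` (definitional). [folklore] -/
@[simp] theorem outT_step (s : OS) (b : Bool) : outT.step s b = outStep s b := rfl

/-- The absorbing state of `outT` emits nothing. [folklore] -/
theorem outT_run_dead (l : List Bool) : (outT.run .dead l).2 = [] := by
  induction l with
  | nil => rfl
  | cons b l ih => simp [FST.run_cons, outStep, ih]

/-- `outT (1 b l) = [b]`. [folklore] -/
theorem outT_eval_true_cons (b : Bool) (l : List Bool) : outT.eval (true :: b :: l) = [b] := by
  have he : ∀ w, outT.eval w = (outT.run .o0 w).2 := fun w => by simp [FST.eval, outT]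
  rw [he]
  simp [FST.run_cons, outStep, outT_run_dead]

/-- `outT (0 l) = [0]`. [folklore] -/
theorem outT_eval_false_cons (l : List Bool) : outT.eval (false :: l) = [false] := by
  have he : ∀ w, outT.eval w = (outT.run .o0 w).2 := fun w => by simp [FST.eval, outT]
  rw [he]
  simp [FST.run_cons, outStep, outT_run_dead]

/-! ### Encodings and the polynomial-time stages -/

/-- Encoding of the step results `List Bool ⊕ Bool` of a decider, as in `OracleAlg.IsPolyTime _
encodingBoolBool`: `inl q ↦ 0q`, `inr b ↦ 1b`. [Arora–Barak 2009, §3.4] [cite: AroraBarak2009, §3.4] -/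
def encOutB (r : List Bool ⊕ Bool) : List Bool :=
  ((encodingList Bool).sumBool encodingBoolBool).encode r

/-- `encOutB (inl q) = 0q` (definitional). [folklore] -/
@[simp] theorem encOutB_inl (q : List Bool) : encOutB (Sum.inl q) = false :: q := rfl

/-- `encOutB (inr b) = 1b` (definitional). [folklore] -/
@[simp] theorem encOutB_inr (b : Bool) : encOutB (Sum.inr b) = [true, b] := rfl

/-- Field encoding of (state, state as context). [folklore] -/
def encA (q : St × St) : List (Option Bool) :=
  (OracleAlg.encIn q.1).map some ++ none :: (OracleAlg.encIn q.2).map some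

/-- Field encoding of (step result, state as context). [folklore] -/
def encB (q : (List Bool ⊕ Bool) × St) : List (Option Bool) :=
  (encOutB q.1).map some ++ none :: (OracleAlg.encIn q.2).map some

/-- Stage C of the round: forget the query, append the constant answer; or freeze. [folklore] -/
def stageC (q : (List Bool ⊕ Bool) × St) : St :=
  match q.1 with
  | Sum.inl _ => (q.2.1, q.2.2 ++ [[false]])
  | Sum.inr _ => q.2

/-- The round factors as duplicate ▸ step on the first copy ▸ stage C. [folklore] -/
theorem simStep_eq_comp (M : OracleAlg Bool) :
    simStep M = stageC ∘ Prod.map (Function.uncurry M.step) id ∘ fun p : St => (p, p) := by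
  funext p
  obtain ⟨x, as⟩ := p
  simp only [Function.comp_apply, Prod.map_apply, id, Function.uncurry_apply_pair, stageC,
    simStep]

/-- The code of a transcript extended by one answer: `listBool (as ++ [a]) = 11 (listBool as ++ ⟨a, []⟩)`
(unary count incremented in front, the new component appended at the end). [Arora–Barak 2009, §0.1] [cite: AroraBarak2009, §0.1] -/
theorem listBool_encode_append_singleton (as : List (List Bool)) (a : List Bool) :
    (encodingList Bool).listBool.encode (as ++ [a]) =
      true :: true :: ((encodingList Bool).listBool.encode as ++ boolPair a []) := by
  have hfold : ∀ (l : List (List Bool)) (init : List Bool),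
      l.foldr (fun a acc => boolPair ((encodingList Bool).encode a) acc) init =
        l.foldr (fun a acc => boolPair ((encodingList Bool).encode a) acc) [] ++ init := by
    intro l init
    induction l with
    | nil => rfl
    | cons a l ih => rw [List.foldr_cons, List.foldr_cons, ih]; simp [boolPair, List.append_assoc]
  simp only [Encoding.listBool, List.foldr_append, List.foldr_cons, List.foldr_nil,
    List.length_append, List.length_cons, List.length_nil, unaryEncodeNat]
  rw [hfold as (boolPair _ [])]
  simp [boolPair, List.append_assoc]
  rfl

/-- **Stage A is polynomial-time**: `z ↦ ⟨z, z⟩ ↦ z.map some ++ none :: z.map some`. [Arora–Barak 2009, §1.3] [cite: AroraBarak2009, §1.3 and Claim 1.6] -/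
theorem polyTime_stageA :
    PolyTimeComputable OracleAlg.encIn encA (fun p : St => (p, p)) := by
  have hS : PolyTimeComputable (id : List Bool → List Bool) (id : List (Option Bool) → _)
      (PrePost.toField.eval ∘ copyFn) :=
    PolyTimeComputable.comp_holds PrePost.toField.polyTimeComputable_eval copyFn_mem_FP
  refine PolyTimeComputable.of_encode hS OracleAlg.encIn (fun _ => rfl) fun p => ?_
  simp only [id, Function.comp_apply, encA, copyFn_apply, PrePost.toField_eval]

/-- **Stage B is polynomial-time**: the step machine of `M` on the first field
(`PolyTimeComputable.firstField`). [Arora–Barak 2009, §1.3] [cite: AroraBarak2009, §1.3 and Claim 1.6] -/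
theorem polyTime_stageB {M : OracleAlg Bool} (hM : M.IsPolyTime encodingBoolBool) :
    PolyTimeComputable encA encB (Prod.map (Function.uncurry M.step) id) :=
  PolyTimeComputable.firstField (fun p : St => (OracleAlg.encIn p).map some) hM

/-- **Stage C is polynomial-time**: `fromField`, keep the tag (`headT`), `updT`, `swapFn`,
`concatT`. [Arora–Barak 2009, §1.3] [cite: AroraBarak2009, §1.3 and Claim 1.6] -/
theorem polyTime_stageC : PolyTimeComputable encB OracleAlg.encIn stageC := by
  have hW : (concatT.eval ∘ swapFn ∘ updT.eval ∘ mapFstFn headT.eval) ∈ FP :=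
    comp_mem_FP concatT.polyTimeComputable_eval (comp_mem_FP swapFn_mem_FP
      (comp_mem_FP updT.polyTimeComputable_eval (mapFstFn_mem_FP headT.polyTimeComputable_eval)))
  have hS : PolyTimeComputable (id : List (Option Bool) → _) (id : List Bool → List Bool)
      ((concatT.eval ∘ swapFn ∘ updT.eval ∘ mapFstFn headT.eval) ∘ PrePost.fromField.eval) :=
    PolyTimeComputable.comp_holds hW PrePost.fromField.polyTimeComputable_eval
  refine PolyTimeComputable.of_encode hS encB (fun _ => rfl) fun q => ?_
  obtain ⟨r, x, as⟩ := q
  cases r with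
  | inr b =>
    simp only [id, Function.comp_apply, encB, stageC, encOutB_inr, PrePost.fromField_eval,
      mapFstFn_boolPair, headT_eval_cons, updT_eval_true, swapFn_boolPair, concatT_eval,
      List.append_nil]
  | inl y =>
    simp only [id, Function.comp_apply, encB, stageC, encOutB_inl, PrePost.fromField_eval,
      mapFstFn_boolPair, headT_eval_cons]
    rw [show OracleAlg.encIn (x, as) = boolPair x ((encodingList Bool).listBool.encode as) from rfl,
      updT_eval_false, swapFn_boolPair, concatT_eval,
      show OracleAlg.encIn (x, as ++ [[false]]) =
        boolPair x ((encodingList Bool).listBool.encode (as ++ [[false]])) from rfl,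
      listBool_encode_append_singleton]
    simp [boolPair, List.append_assoc]

/-- **The round `simStep M` is polynomial-time** on encoded states. [Arora–Barak 2009, §1.3, §3.4] [cite: AroraBarak2009, §3.4 Example 3.6 (2)] -/
theorem polyTime_simStep {M : OracleAlg Bool} (hM : M.IsPolyTime encodingBoolBool) :
    PolyTimeComputable OracleAlg.encIn OracleAlg.encIn (simStep M) := by
  rw [simStep_eq_comp]
  exact PolyTimeComputable.comp_holds polyTime_stageC
    (PolyTimeComputable.comp_holds (polyTime_stageB hM) polyTime_stageA)

/-- **Input preparation is polynomial-time**: `x ↦ none^{q(|x|)} ++ (encIn (x, [])).map some` by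
`rePair ∘ dup` (`⟨x, []⟩`), `mapSndFn const01T` (`⟨x, 01⟩ = encIn (x, [])`), the unary clock
`evalHdrFn q` and the recoding transducer `itInit` (`IterateFP.lean`). [Arora–Barak 2009, §1.4.1, §3.1 (polynomials are time constructible)] [cite: AroraBarak2009, §1.4.1] -/
theorem polyTime_prep (q : Polynomial ℕ) :
    PolyTimeComputable (id : List Bool → List Bool)
      (fun s : St × ℕ => List.replicate s.2 none ++ (OracleAlg.encIn s.1).map some)
      (fun x => (((x, []) : St), q.eval x.length)) := by
  have hW : (evalHdrFn q ∘ mapSndFn const01T.eval ∘ rePair ∘ StrCopy.dup) ∈ FP :=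
    comp_mem_FP (evalHdrFn_mem_FP q) (comp_mem_FP (mapSndFn_mem_FP const01T.polyTimeComputable_eval)
      (comp_mem_FP rePair_mem_FP StrCopy.dup_mem_FP))
  have hS : PolyTimeComputable (id : List Bool → List Bool) (id : List (Option Bool) → _)
      (itInit.eval ∘ evalHdrFn q ∘ mapSndFn const01T.eval ∘ rePair ∘ StrCopy.dup) :=
    PolyTimeComputable.comp_holds itInit.polyTimeComputable_eval hW
  refine PolyTimeComputable.of_encode hS id (fun _ => rfl) fun x => ?_
  have h01 : OracleAlg.encIn ((x, []) : St) = boolPair x [false, true] := rfl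
  simp only [id, Function.comp_apply, StrCopy.rePair_dup, mapSndFn_boolPair, const01T_eval, evalHdrFn,
    boolUnpair_boolPair, itInit_eval, stageIt_hdr, h01]

/-- **Reading off the output is polynomial-time**: `encOutB r ↦ [simOut]`. [folklore] -/
theorem polyTime_out :
    PolyTimeComputable encOutB encodeBool
      (fun r : List Bool ⊕ Bool => match r with | Sum.inl _ => false | Sum.inr b => b) := by
  refine PolyTimeComputable.of_encode outT.polyTimeComputable_eval encOutB (fun _ => rfl) fun r => ?_
  cases r with
  | inl y => simp only [id, encOutB_inl, outT_eval_false_cons]; rfl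
  | inr b => simp only [id, encOutB_inr, outT_eval_true_cons]; rfl

end EmptySim

open EmptySim

/-- **`P^∅ ⊆ P`**: a language decided relative to the empty oracle within `q(|x|)` rounds is
decided by the polynomial-time machine "prepare the clock, iterate `simStep M` `q(|x|)` times
(`PolyTimeComputable.iterate_of_le_add`, growth `6` per round), run the step once more and read
off the output" (`simOut_iterate`). [Baker–Gill–Solovay 1975, §1] [cite: BakerGillSolovay1975, §1] -/
theorem PRel_empty_subset_P : PRel Oracle.empty ⊆ Classes.P := by
  intro L hL
  obtain ⟨M, hM, q, hq⟩ := hL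
  -- the clocked iteration of the round
  have hIt : PolyTimeComputable
      (fun s : St × ℕ => List.replicate s.2 none ++ (OracleAlg.encIn s.1).map some)
      OracleAlg.encIn (fun s => (simStep M)^[s.2] s.1) :=
    PolyTimeComputable.iterate_of_le_add 6 (length_encIn_simStep_le M) (polyTime_simStep hM)
  have h3 : PolyTimeComputable (id : List Bool → List Bool) OracleAlg.encIn
      (fun x => (simStep M)^[q.eval x.length] ((x, []) : St)) :=
    PolyTimeComputable.comp_holds hIt (polyTime_prep q)
  have h4 : PolyTimeComputable (id : List Bool → List Bool) encOutB
      (Function.uncurry M.step ∘ fun x => (simStep M)^[q.eval x.length] ((x, []) : St)) :=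
    PolyTimeComputable.comp_holds hM h3
  have h5 := PolyTimeComputable.comp_holds polyTime_out h4
  refine mem_P_iff_holds.2 (polyTimeDecidable_iff.2 ?_)
  refine PolyTimeComputable.of_encode h5 id (fun _ => rfl) fun x => ?_
  -- correctness: the read-off output is `[x ∈ L]`
  have hrun : M.runAux Oracle.empty x (q.eval x.length) [] = some (L.boolIndicator x) := (hq x).1
  exact congrArg encodeBool (simOut_iterate M x hrun)

/-- **Discharge of `PRel_empty`: `P^∅ = P`** (`PRel_empty_subset_P` and the query-free embedding
`P_subset_PRel_holds`). [Baker–Gill–Solovay 1975, §1] [cite: BakerGillSolovay1975, §1] -/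
theorem PRel_empty_holds : PRel_empty :=
  Set.Subset.antisymm PRel_empty_subset_P (P_subset_PRel_holds Oracle.empty)

/-- Hence `NP^∅ = NP` (`NPRel O = ∃·P^O`). [Baker–Gill–Solovay 1975, §1] [cite: BakerGillSolovay1975, §1] -/
theorem NPRel_empty : NPRel Oracle.empty = Nondeterministic.NP := by
  rw [NPRel, PRel_empty_holds]
  rfl

/-- Hence `BPP^∅ = BPP` (`BPPRel O = BP·P^O`, `BPP = BP·P`). [Baker–Gill–Solovay 1975, §1] [cite: BakerGillSolovay1975, §1] -/
theorem BPPRel_empty : BPPRel Oracle.empty = BPP := by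
  rw [BPPRel, PRel_empty_holds]
  rfl

end Literature.Computability.Complexity
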